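import Mathlib

/-!
# Tier4/Common/SL2ConeMeasure — the cone measure on `SL(2, ℝ)` is a Haar measure; every Haar measure is a multiple of it

Blind re-derivation cell `pub-hodge-repro`, Tier 4 (README §9–§10), seat t4-typer-2 (gen 5).  Target tree path
`lean/Summits/Ventures/HodgeRepro/Tier4/Common/SL2ConeMeasure.lean`.  Imports Mathlib only.  Module 1/3 of
C-COMMON-SL2BALL stage A (bus S15425; plan-4 g5's plate line S15469), the Mathlib-level core behind the archimedean ball
print `ArchBallGrowth` of C-L4-ARCHBALL-REDUCE (S15402 / ArchBallReduce, L4-p2).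

WHAT IS TYPED — a CONCRETE Haar measure on `SL(2, ℝ)` built from Lebesgue measure, with no Lie theory and no `KAK`
integration formula:
* `V := (Fin 2 → ℝ) × (Fin 2 → ℝ)` (two column vectors) carries Lebesgue measure (`isAddHaarMeasure_volume_V`);
  `matV p` is the matrix with columns `p.1, p.2`, `detV p = p.1 0 * p.2 1 - p.1 1 * p.2 0` its determinant (`det_matV`).
* `ι : SL(2, ℝ) → V` (columns), `lmul g : V →ₗ[ℝ] V` = left multiplication by `g`, of determinant `(det g)² = 1`
  (`det_lmul`), hence Lebesgue-measure preserving (`map_lmul_volume`, from `map_linearMap_addHaar_eq_smul_addHaar`).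
* the RETRACTION `ρ p = (√(detV p))⁻¹ • matV p` for `detV p > 0` (junk `1` otherwise): `ρ (t • ι a) = a` for `t > 0`,
  `√(detV p) • ι (ρ p) = p`, `ρ (lmul g p) = g * ρ p`; continuous on `{detV > 0}`, measurable.
* the CONE MEASURE `coneMeasure := Measure.map ρ (volume.restrict D)`, `D = {1 < detV ≤ 4}` — i.e.
  `coneMeasure A = vol {t • a : a ∈ A, 1 < t ≤ 2}` — is left-invariant (`isMulLeftInvariant_coneMeasure`), finite on
  compacts (the cone over a compact is the continuous image of `K ×ˢ [1, 2]`) and positive on non-empty opens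
  (`(a, t) ↦ t • a` is open onto `{detV > 0}`): **`isHaarMeasure_coneMeasure`**.
* **`exists_eq_smul_coneMeasure (μ) [IsHaarMeasure μ] : ∃ c : ℝ≥0, μ = c • coneMeasure`** (uniqueness of Haar measure,
  `isMulLeftInvariant_eq_smul`; `SL(2, ℝ)` is locally compact and second countable as a closed subset of `M₂(ℝ)`).
The measurable structure on `SL(2, ℝ)` is a binder `[MeasurableSpace SL(2, ℝ)] [BorelSpace SL(2, ℝ)]` (no instance is
declared here).  Modules 2/3 (`SL2BallFubini`, `SL2BallGrowth`) estimate `coneMeasure` of the `ℓ¹` balls.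

Nothing here says anything about the status of the Hodge conjecture for CM abelian varieties, which is NOT proved
(HC_CM is NOT proved by anyone in this repository).
-/

set_option autoImplicit false

noncomputable section

open MeasureTheory Measure Set Function Topology
open scoped NNReal ENNReal Pointwise MatrixGroups

namespace Summit.Ventures.HodgeRepro.Tier4.Common

namespace SL2Ball

/-! ## 1. The ambient space, the matrix of two columns, the determinant polynomial -/

/-- The ambient space: a pair of column vectors, i.e. a `2 × 2` real matrix read column by column. -/
abbrev V : Type := (Fin 2 → ℝ) × (Fin 2 → ℝ)

/-- The matrix whose columns are `p.1` and `p.2`. -/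
def matV (p : V) : Matrix (Fin 2) (Fin 2) ℝ := Matrix.of fun i j => ![p.1 i, p.2 i] j

/-- The determinant of `matV p`, as an explicit polynomial in the four coordinates. -/
def detV (p : V) : ℝ := p.1 0 * p.2 1 - p.1 1 * p.2 0

/-- The first column of `matV p` is `p.1`. -/
@[simp] theorem matV_apply_zero (p : V) (i : Fin 2) : matV p i 0 = p.1 i := by simp [matV]

/-- The second column of `matV p` is `p.2`. -/
@[simp] theorem matV_apply_one (p : V) (i : Fin 2) : matV p i 1 = p.2 i := by simp [matV]

/-- `det (matV p) = detV p`. -/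
theorem det_matV (p : V) : (matV p).det = detV p := by
  rw [Matrix.det_fin_two]
  simp only [matV_apply_zero, matV_apply_one, detV]
  ring

/-- The columns of a matrix. -/
def colsOf (A : Matrix (Fin 2) (Fin 2) ℝ) : V := (fun i => A i 0, fun i => A i 1)

/-- `matV ∘ colsOf = id`. -/
@[simp] theorem matV_colsOf (A : Matrix (Fin 2) (Fin 2) ℝ) : matV (colsOf A) = A := by
  ext i j
  fin_cases j <;> simp [colsOf]

/-- `colsOf ∘ matV = id`. -/
@[simp] theorem colsOf_matV (p : V) : colsOf (matV p) = p := by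
  ext i <;> simp [colsOf]

/-- `matV` commutes with scalars. -/
theorem matV_smul (t : ℝ) (p : V) : matV (t • p) = t • matV p := by
  ext i j
  fin_cases j <;> simp

/-- `detV (t • p) = t² detV p`. -/
theorem detV_smul (t : ℝ) (p : V) : detV (t • p) = t ^ 2 * detV p := by
  simp only [detV, Prod.smul_fst, Prod.smul_snd, Pi.smul_apply, smul_eq_mul]
  ring

/-- `detV` is continuous. -/
theorem continuous_detV : Continuous detV := by
  unfold detV
  fun_prop

/-- `matV` is continuous. -/
theorem continuous_matV : Continuous matV := by
  refine continuous_pi fun i => continuous_pi fun j => ?_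
  fin_cases j <;> simp [matV] <;> fun_prop

/-- `colsOf` is continuous. -/
theorem continuous_colsOf : Continuous colsOf := by
  unfold colsOf
  fun_prop

/-! ## 2. The embedding of `SL(2, ℝ)` and the left multiplication -/

/-- The embedding `SL(2, ℝ) → V`, column by column. -/
def ι (a : SL(2, ℝ)) : V := colsOf (a : Matrix (Fin 2) (Fin 2) ℝ)

/-- `matV (ι a) = a`. -/
@[simp] theorem matV_ι (a : SL(2, ℝ)) : matV (ι a) = (a : Matrix (Fin 2) (Fin 2) ℝ) := matV_colsOf _

/-- `detV (ι a) = 1` for `a ∈ SL(2, ℝ)`. -/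
theorem detV_ι (a : SL(2, ℝ)) : detV (ι a) = 1 := by
  rw [← det_matV, matV_ι, Matrix.SpecialLinearGroup.det_coe]

/-- `ι` is continuous. -/
theorem continuous_ι : Continuous ι :=
  continuous_colsOf.comp continuous_subtype_val

/-- `ι` is injective. -/
theorem ι_injective : Injective ι := by
  intro a b h
  apply Subtype.ext
  rw [← matV_ι a, ← matV_ι b, h]

/-- Left multiplication by `g ∈ SL(2, ℝ)` on `V` (column by column), as a linear map. -/
def lmul (g : SL(2, ℝ)) : V →ₗ[ℝ] V :=
  (Matrix.toLin' (g : Matrix (Fin 2) (Fin 2) ℝ)).prodMap (Matrix.toLin' (g : Matrix (Fin 2) (Fin 2) ℝ))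

/-- `matV (lmul g p) = g * matV p`: `lmul g` is left multiplication by `g`, column by column. -/
theorem matV_lmul (g : SL(2, ℝ)) (p : V) : matV (lmul g p) = (g : Matrix (Fin 2) (Fin 2) ℝ) * matV p := by
  ext i j
  fin_cases i <;> fin_cases j <;> simp [lmul, Matrix.mul_apply]

/-- `detV (lmul g p) = detV p` (`det g = 1`). -/
theorem detV_lmul (g : SL(2, ℝ)) (p : V) : detV (lmul g p) = detV p := by
  rw [← det_matV, matV_lmul, Matrix.det_mul, Matrix.SpecialLinearGroup.det_coe, one_mul, det_matV]

/-- `lmul g` has determinant `(det g)² = 1`. -/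
theorem det_lmul (g : SL(2, ℝ)) : LinearMap.det (lmul g) = 1 := by
  rw [lmul, LinearMap.det_prodMap, LinearMap.det_toLin', Matrix.SpecialLinearGroup.det_coe, one_mul]

/-- `lmul g` is continuous (a linear map of a finite-dimensional space). -/
theorem continuous_lmul (g : SL(2, ℝ)) : Continuous (lmul g) :=
  (lmul g).continuous_of_finiteDimensional

/-- `lmul (g * h) = lmul g ∘ lmul h`. -/
theorem lmul_mul (g h : SL(2, ℝ)) (p : V) : lmul (g * h) p = lmul g (lmul h p) := by
  rw [← colsOf_matV (lmul (g * h) p), ← colsOf_matV (lmul g (lmul h p)), matV_lmul, matV_lmul, matV_lmul,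
    Matrix.SpecialLinearGroup.coe_mul, Matrix.mul_assoc]

/-- Lebesgue measure on `V` is an additive Haar measure (the product instance, made explicit). -/
theorem isAddHaarMeasure_volume_V : IsAddHaarMeasure (volume : Measure V) := by
  rw [volume_eq_prod]
  exact Measure.prod.instIsAddHaarMeasure volume volume

/-- Left multiplication preserves Lebesgue measure on `V`. -/
theorem map_lmul_volume (g : SL(2, ℝ)) : Measure.map (lmul g) (volume : Measure V) = volume := by
  haveI := isAddHaarMeasure_volume_V
  rw [map_linearMap_addHaar_eq_smul_addHaar (μ := (volume : Measure V)) (f := lmul g) (by rw [det_lmul]; exact one_ne_zero),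
    det_lmul, inv_one, abs_one, ENNReal.ofReal_one, one_smul]

/-! ## 3. The retraction `ρ : V → SL(2, ℝ)` -/

/-- For `detV p > 0` the rescaled matrix `(√(detV p))⁻¹ • matV p` has determinant `1`. -/
theorem det_smul_matV_of_pos {p : V} (hp : 0 < detV p) :
    ((Real.sqrt (detV p))⁻¹ • matV p).det = 1 := by
  rw [Matrix.det_smul, det_matV, Fintype.card_fin, inv_pow, Real.sq_sqrt hp.le, inv_mul_cancel₀ hp.ne']

/-- The retraction: rescale a matrix of positive determinant to determinant one (junk value `1` otherwise). -/
def ρ (p : V) : SL(2, ℝ) :=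
  if h : 0 < detV p then ⟨(Real.sqrt (detV p))⁻¹ • matV p, det_smul_matV_of_pos h⟩ else 1

/-- The matrix of `ρ p` for `detV p > 0`. -/
theorem coe_ρ_of_pos {p : V} (hp : 0 < detV p) :
    (ρ p : Matrix (Fin 2) (Fin 2) ℝ) = (Real.sqrt (detV p))⁻¹ • matV p := by
  simp [ρ, hp]

/-- The junk value of `ρ` off `{detV > 0}`. -/
theorem ρ_of_not_pos {p : V} (hp : ¬ 0 < detV p) : ρ p = 1 := by
  simp [ρ, hp]

/-- `ρ (t • ι a) = a` for `t > 0`: `ρ` retracts the positive cone over `SL(2, ℝ)` onto `SL(2, ℝ)`. -/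
theorem ρ_smul_ι {t : ℝ} (ht : 0 < t) (a : SL(2, ℝ)) : ρ (t • ι a) = a := by
  have hd : detV (t • ι a) = t ^ 2 := by rw [detV_smul, detV_ι, mul_one]
  have hpos : 0 < detV (t • ι a) := by rw [hd]; positivity
  apply Subtype.ext
  rw [coe_ρ_of_pos hpos, hd, Real.sqrt_sq ht.le, matV_smul, matV_ι, smul_smul, inv_mul_cancel₀ ht.ne', one_smul]

/-- `ρ ∘ ι = id`. -/
theorem ρ_ι (a : SL(2, ℝ)) : ρ (ι a) = a := by
  simpa using ρ_smul_ι one_pos a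

/-- `√(detV p) • ι (ρ p) = p` for `detV p > 0`: every point of the positive cone is `t • a` with `a = ρ p`, `t = √(detV p)`. -/
theorem smul_ι_ρ {p : V} (hp : 0 < detV p) : Real.sqrt (detV p) • ι (ρ p) = p := by
  have hs : Real.sqrt (detV p) ≠ 0 := (Real.sqrt_pos.2 hp).ne'
  rw [← colsOf_matV (Real.sqrt (detV p) • ι (ρ p)), matV_smul, matV_ι, coe_ρ_of_pos hp, smul_smul,
    mul_inv_cancel₀ hs, one_smul, colsOf_matV]

/-- `ρ (lmul g p) = g * ρ p` for `detV p > 0`: the retraction is `SL(2, ℝ)`-equivariant. -/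
theorem ρ_lmul (g : SL(2, ℝ)) {p : V} (hp : 0 < detV p) : ρ (lmul g p) = g * ρ p := by
  have hp' : 0 < detV (lmul g p) := by rwa [detV_lmul]
  apply Subtype.ext
  rw [Matrix.SpecialLinearGroup.coe_mul, coe_ρ_of_pos hp', coe_ρ_of_pos hp, detV_lmul, matV_lmul, Matrix.mul_smul]

/-- `ρ` is continuous on the open set `{detV > 0}`. -/
theorem continuousOn_ρ : ContinuousOn ρ {p : V | 0 < detV p} := by
  rw [continuousOn_iff_continuous_restrict]
  have : ({p : V | 0 < detV p}).restrict ρ =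
      fun x => ⟨(Real.sqrt (detV x.1))⁻¹ • matV x.1, det_smul_matV_of_pos x.2⟩ := by
    funext x
    simp only [Set.restrict_apply, ρ]
    exact dif_pos x.2
  rw [this]
  have hm : Continuous (fun x : {p : V | 0 < detV p} => matV x.1) := continuous_matV.comp continuous_subtype_val
  have hs : Continuous (fun x : {p : V | 0 < detV p} => (Real.sqrt (detV x.1))⁻¹) := by
    refine Continuous.inv₀ (Real.continuous_sqrt.comp (continuous_detV.comp continuous_subtype_val)) ?_
    intro x
    exact (Real.sqrt_pos.2 x.2).ne'
  exact Continuous.subtype_mk (hs.smul hm) _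

/-- `ρ` is measurable (continuous on the open set `{detV > 0}`, constant on its complement). -/
theorem measurable_ρ [MeasurableSpace SL(2, ℝ)] [BorelSpace SL(2, ℝ)] : Measurable ρ := by
  have hS : MeasurableSet {p : V | 0 < detV p} := measurableSet_lt measurable_const continuous_detV.measurable
  refine measurable_of_restrict_of_restrict_compl hS ?_ ?_
  · exact (continuousOn_iff_continuous_restrict.1 continuousOn_ρ).measurable
  · have : ({p : V | 0 < detV p}ᶜ).restrict ρ = fun _ => 1 := by
      funext x
      exact ρ_of_not_pos x.2
    rw [this]
    exact measurable_const

/-! ## 4. The cone region and the cone measure -/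

/-- The cone region `{1 < detV ≤ 4}`: the matrices `t • a` with `a ∈ SL(2, ℝ)` and `1 < t ≤ 2`. -/
def D : Set V := {p | 1 < detV p ∧ detV p ≤ 4}

/-- The cone region `D` is measurable. -/
theorem measurableSet_D : MeasurableSet D :=
  (measurableSet_lt measurable_const continuous_detV.measurable).inter
    (measurableSet_le continuous_detV.measurable measurable_const)

/-- On `D` the determinant is positive. -/
theorem pos_of_mem_D {p : V} (hp : p ∈ D) : 0 < detV p := zero_lt_one.trans hp.1

/-- `lmul g` preserves the cone region `D` (`detV` is `lmul`-invariant). -/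
theorem lmul_preimage_D (g : SL(2, ℝ)) : lmul g ⁻¹' D = D := by
  ext p
  simp [D, detV_lmul]

/-- **The cone measure** on `SL(2, ℝ)`: the image of Lebesgue measure on the cone region `D` under the retraction `ρ`,
so that `coneMeasure A = vol {t • a : a ∈ A, 1 < t ≤ 2}`. -/
def coneMeasure [MeasurableSpace SL(2, ℝ)] : Measure SL(2, ℝ) :=
  Measure.map ρ ((volume : Measure V).restrict D)

/-- `SL(2, ℝ)` is Hausdorff (a subspace of `M₂(ℝ)`). -/
theorem t2Space_SL2 : T2Space SL(2, ℝ) :=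
  Matrix.SpecialLinearGroup.isClosedEmbedding_val.isEmbedding.t2Space

/-- `SL(2, ℝ)` is locally compact (a closed subset of `M₂(ℝ)`). -/
theorem locallyCompactSpace_SL2 : LocallyCompactSpace SL(2, ℝ) :=
  haveI : LocallyCompactSpace (Matrix (Fin 2) (Fin 2) ℝ) :=
    inferInstanceAs (LocallyCompactSpace (Fin 2 → Fin 2 → ℝ))
  Matrix.SpecialLinearGroup.isClosedEmbedding_val.locallyCompactSpace

/-- `SL(2, ℝ)` is second countable (a subspace of `M₂(ℝ)`). -/
theorem secondCountableTopology_SL2 : SecondCountableTopology SL(2, ℝ) :=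
  haveI : SecondCountableTopology (Matrix (Fin 2) (Fin 2) ℝ) :=
    inferInstanceAs (SecondCountableTopology (Fin 2 → Fin 2 → ℝ))
  Matrix.SpecialLinearGroup.isClosedEmbedding_val.isEmbedding.secondCountableTopology

section Haar

variable [MeasurableSpace SL(2, ℝ)] [BorelSpace SL(2, ℝ)]

/-- `coneMeasure s = vol (ρ ⁻¹' s ∩ D)` for measurable `s`. -/
theorem coneMeasure_apply {s : Set SL(2, ℝ)} (hs : MeasurableSet s) :
    coneMeasure s = volume (ρ ⁻¹' s ∩ D) := by
  rw [coneMeasure, Measure.map_apply measurable_ρ hs, Measure.restrict_apply (measurable_ρ hs)]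

/-- The cone measure is left-invariant: left multiplication by `g` on `V` has determinant `1`. -/
theorem isMulLeftInvariant_coneMeasure : IsMulLeftInvariant coneMeasure := by
  refine ⟨fun g => ?_⟩
  have hmul : Measurable (fun x : SL(2, ℝ) => g * x) := measurable_const_mul g
  rw [coneMeasure, Measure.map_map hmul measurable_ρ]
  have hae : (fun x : SL(2, ℝ) => g * x) ∘ ρ =ᵐ[(volume : Measure V).restrict D] ρ ∘ lmul g := by
    refine (ae_restrict_iff' measurableSet_D).2 (Filter.Eventually.of_forall fun p hp => ?_)
    simp only [Function.comp_apply]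
    rw [ρ_lmul g (pos_of_mem_D hp)]
  have h1 : Measure.map (lmul g) ((volume : Measure V).restrict D) = (volume : Measure V).restrict D := by
    conv_lhs => rw [← lmul_preimage_D g]
    rw [← Measure.restrict_map (continuous_lmul g).measurable measurableSet_D, map_lmul_volume]
  rw [Measure.map_congr hae, ← Measure.map_map measurable_ρ (continuous_lmul g).measurable, h1]

/-- The cone measure is finite on compacts: the cone over a compact set is compact. -/
theorem isFiniteMeasureOnCompacts_coneMeasure : IsFiniteMeasureOnCompacts coneMeasure := by
  haveI := isAddHaarMeasure_volume_V
  haveI := t2Space_SL2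
  refine ⟨fun K hK => ?_⟩
  rw [coneMeasure_apply hK.isClosed.measurableSet]
  have hsub : ρ ⁻¹' K ∩ D ⊆ (fun q : SL(2, ℝ) × ℝ => q.2 • ι q.1) '' (K ×ˢ Icc 1 2) := by
    rintro p ⟨hpK, hpD⟩
    refine ⟨(ρ p, Real.sqrt (detV p)), ⟨hpK, ?_, ?_⟩, smul_ι_ρ (pos_of_mem_D hpD)⟩
    · simpa using Real.sqrt_le_sqrt hpD.1.le
    · have h4 : Real.sqrt 4 = 2 := by
        rw [show (4 : ℝ) = 2 ^ 2 by norm_num, Real.sqrt_sq (by norm_num)]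
      exact h4 ▸ Real.sqrt_le_sqrt hpD.2
  have hcont : Continuous (fun q : SL(2, ℝ) × ℝ => q.2 • ι q.1) :=
    continuous_snd.smul (continuous_ι.comp continuous_fst)
  calc volume (ρ ⁻¹' K ∩ D) ≤ volume ((fun q : SL(2, ℝ) × ℝ => q.2 • ι q.1) '' (K ×ˢ Icc 1 2)) :=
        measure_mono hsub
    _ < ⊤ := ((hK.prod isCompact_Icc).image hcont).measure_lt_top

/-- The cone measure is positive on non-empty open sets: `(a, t) ↦ t • a` is open onto `{detV > 0}`. -/
theorem isOpenPosMeasure_coneMeasure : IsOpenPosMeasure coneMeasure := by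
  haveI := isAddHaarMeasure_volume_V
  refine ⟨fun U hU hUne => ?_⟩
  rw [coneMeasure_apply hU.measurableSet]
  obtain ⟨a, ha⟩ := hUne
  have hSo : IsOpen {p : V | 0 < detV p} := isOpen_lt continuous_const continuous_detV
  have hW : IsOpen ({p : V | 0 < detV p} ∩ ρ ⁻¹' U ∩ {p | 1 < detV p ∧ detV p < 4}) :=
    (continuousOn_ρ.isOpen_inter_preimage hSo hU).inter
      ((isOpen_lt continuous_const continuous_detV).inter (isOpen_lt continuous_detV continuous_const))
  have hsub : {p : V | 0 < detV p} ∩ ρ ⁻¹' U ∩ {p | 1 < detV p ∧ detV p < 4} ⊆ ρ ⁻¹' U ∩ D := by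
    rintro p ⟨⟨-, hpU⟩, h1, h4⟩
    exact ⟨hpU, h1, h4.le⟩
  have hne : ({p : V | 0 < detV p} ∩ ρ ⁻¹' U ∩ {p | 1 < detV p ∧ detV p < 4}).Nonempty := by
    have hd : detV ((3 / 2 : ℝ) • ι a) = 9 / 4 := by
      rw [detV_smul, detV_ι]; norm_num
    refine ⟨(3 / 2 : ℝ) • ι a, ⟨⟨?_, ?_⟩, ?_, ?_⟩⟩
    · show 0 < detV ((3 / 2 : ℝ) • ι a)
      rw [hd]; norm_num
    · show ρ ((3 / 2 : ℝ) • ι a) ∈ U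
      rw [ρ_smul_ι (by norm_num) a]; exact ha
    · show 1 < detV ((3 / 2 : ℝ) • ι a)
      rw [hd]; norm_num
    · show detV ((3 / 2 : ℝ) • ι a) < 4
      rw [hd]; norm_num
  exact ((hW.measure_pos volume hne).trans_le (measure_mono hsub)).ne'

/-- **The cone measure is a Haar measure on `SL(2, ℝ)`.** -/
theorem isHaarMeasure_coneMeasure : IsHaarMeasure coneMeasure :=
  haveI := isFiniteMeasureOnCompacts_coneMeasure
  haveI := isMulLeftInvariant_coneMeasure
  haveI := isOpenPosMeasure_coneMeasure
  ⟨⟩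

/-- **Every Haar measure on `SL(2, ℝ)` is a constant multiple of the cone measure** (uniqueness of Haar measure). -/
theorem exists_eq_smul_coneMeasure (μ : Measure SL(2, ℝ)) [IsHaarMeasure μ] :
    ∃ c : ℝ≥0, μ = c • coneMeasure := by
  haveI := locallyCompactSpace_SL2
  haveI := secondCountableTopology_SL2
  haveI := isHaarMeasure_coneMeasure
  exact ⟨haarScalarFactor μ coneMeasure, isMulLeftInvariant_eq_smul μ coneMeasure⟩

end Haar

end SL2Ball

end Summit.Ventures.HodgeRepro.Tier4.Common
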